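import Literature.NumberTheory.Automorphic.HyperspecialUnitarySatakeDuality
import HarnessLib

/-!
# The Satake isomorphism for the unramified unitary groups of relative rank one (`U(2)`, `U(3)`) over ANY commutative
# ring: the counting transform maps `ℋ(U(σ, J₀), K₀; R)` isomorphically onto
# `{f ∈ R[Λ] : f = 0 off the antisymmetric lattice, f_λ = [K_P : t_λ K_P t_λ⁻¹] · f_{-λ} (λ dominant)}`
# (Cartier Thm. 4.1 in relative rank one; Mínguez §4; Satake 1963)

Topic `NumberTheory/Automorphic`; namespace `Literature.NumberTheory.Automorphic.HermitianLattice.UnramifiedLocalConjDatum`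
(lane `lit-hodgefound`, Track 2 foundations; seat `lit-hodgefound-p11`, generation 44, row g44-#9).  THEOREMS ONLY: no
definition, no named fact, no instance, no notation.  Sequel of `HyperspecialUnitarySatakeDuality` (g44-#3: the `w₀`-symmetry of
`𝒮_1(T)` for every `T`) in RELATIVE RANK ONE — the antisymmetric lattice `Λ⁻ = {μ : μ ∘ rev = -μ}` is a line, parametrised
by `μ ↦ μ 0` (an abstract «linear parametrisation» `ℓ : ℤ → Λ⁻`, §2, which exists exactly for `N = 2`: `ℓ_m = (m, -m)` and
`N = 3`: `ℓ_m = (m, 0, -m)`, §3) — combined with the tree's injectivity (`satakeTransform_injective_of_commRing`),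
antidominant dominance (`sum_ite_lt_le_sum_iwasawaExp_of_mem_orbit`) and unique bottom coset
(`coeff_satakeTransform_doubleCosetOperator_zpowDiagGL_monotone_unitary`).

## The mathematics

When `Λ⁻` is a line `{ℓ_m : m ∈ ℤ}` (`ℓ_m 0 = m`, `ℓ_m` monotone for `m ≤ 0`, antitone for `m ≥ 0`), all Iwasawa exponents are
antisymmetric (`iwasawaExp_rev`), and g44-#3 gives for every `T ∈ ℋ = ℋ(U(σ,J₀), K₀; R)` and every dominant antisymmetric `λ`:
`𝒮_1(T)_λ = E(λ) · 𝒮_1(T)_{-λ}`, `E(λ) = [K_P : t_λ K_P t_λ⁻¹]` (`t_λ = diag(ϖ^λ)`, `K_P = P ∩ K₀`).  So the image of the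
COUNTING transform `𝒮_1 : ℋ →ₐ[R] R[ℤ^N]` lies in

  `V = {f : f_μ = 0 for μ ∉ Λ⁻; f_λ = E(λ) f_{-λ} for λ ∈ Λ⁻ dominant}`   (`coeff_satakeTransform_eq_zero_of_not_rev`,
  g44-#3 `coeff_satakeTransform_one_eq_relIndex_mul_of_antitone_unitary`),

and conversely **every `f ∈ V` is a transform** (`mem_range_satakeTransform_one_of_linear_unitary`): induct from the BOTTOM —
`𝒮_1(T_{t_{ℓ_{-k}}})` lies in `V`, is supported on `{μ : μ 0 ≥ -k}` (Bruhat–Tits dominance from the antidominant end) and has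
coefficient `1` at `x^{ℓ_{-k}}` (unique bottom coset), so subtracting `f_{ℓ_{-k}} · 𝒮_1(T_{t_{ℓ_{-k}}})` lowers `k`.  With the
tree's injectivity: **`𝒮_1 : ℋ(U(σ,J₀), K₀; R) ⥲ V` for every commutative ring `R`**, for `N = 2` and `N = 3`
(`range_satakeTransform_one_unitary_two/three`, `satakeTransform_one_bijective_unitary_two/three`) — Cartier's Theorem 4.1 /
the unramified Satake isomorphism of `U(2)`, `U(3)` with the `w₀`-action twisted by the modulus index (counting normalisation).

## What is formalised (theorems only)

* §1 (any `N`) `coeff_satakeTransform_eq_zero_of_not_rev` (transforms vanish off `Λ⁻`), `sum_ite_lt_one`.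
* §2 (any `N`, abstract line `ℓ`) `coeff_satakeTransform_one_bottom_eq_zero_of_lt` (support of `𝒮_1(T_{t_{ℓ_{-k}}})` is
  `μ 0 ≥ -k`), `coeff_satakeTransform_one_bottom_self` (bottom coefficient `1`),
  **`mem_range_satakeTransform_one_of_linear_unitary`** (`V ⊆ range`), **`range_satakeTransform_one_of_linear_unitary`**
  (`range 𝒮_1 = V`), `satakeTransform_one_bijective_of_linear_unitary`.
* §3 the lines: `rev_linear_three`, `eq_linear_three_of_rev` (`μ = (μ₀, 0, -μ₀)`), `monotone/antitone_linear_three`,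
  `rev_linear_two`, `eq_linear_two_of_rev` (`μ = (μ₀, -μ₀)`), `monotone/antitone_linear_two`; the isomorphisms
  **`range_satakeTransform_one_unitary_three`**, **`satakeTransform_one_bijective_unitary_three`**,
  **`range_satakeTransform_one_unitary_two`**, **`satakeTransform_one_bijective_unitary_two`**.

## References
* [CartierCorvallis1979] P. Cartier, *Representations of 𝔭-adic groups: a survey*, PSPM 33.1 (1979), §IV (4.2), Thm. 4.1.
* [Minguez2011] A. Mínguez, *Unramified representations of unitary groups*, in: *On the stabilization of the trace formula*
  (2011), §4.
* [Satake1963] I. Satake, Publ. Math. IHÉS 18 (1963), §§6–7.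
* [BruhatTits1972] F. Bruhat, J. Tits, *Groupes réductifs sur un corps local I*, Publ. Math. IHÉS 41 (1972), (4.4.3), (4.4.4).
-/

noncomputable section

open scoped Valued WithZero Matrix MatrixGroups Pointwise
open MonoidAlgebra Representation Finset MulAction ConjAct

namespace Literature.NumberTheory.Automorphic.HermitianLattice

open Literature.NumberTheory.Automorphic.CartanUnique Literature.NumberTheory.Automorphic.SymplecticCartan

variable {K : Type*} [Field K] [Valued K ℤᵐ⁰] {σ : K →+* K} {ϖ : K} {N : ℕ}

namespace UnramifiedLocalConjDatum

/-! ## §1 Transforms vanish off the antisymmetric lattice; head sums of length one -/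

/-- **Transforms vanish off the antisymmetric lattice** (any `N`): every Iwasawa exponent satisfies `a(g) ∘ rev = -a(g)`, so
the coefficient of `x^μ` in `𝒮_w(T)` is `0` unless `μ ∘ rev = -μ`. [cite: BruhatTits1972, (4.4.3)] [cite: CartierCorvallis1979, §IV (4.2)] -/
theorem coeff_satakeTransform_eq_zero_of_not_rev (hd : UnramifiedLocalConjDatum σ ϖ) {R : Type*} [CommRing R]
    (w : Multiplicative (Fin N → ℤ) →* R)
    (T : heckeAlgebra R (unitaryGroupOfForm σ ((StdForm.antidiagonal N).over K)) (unitaryInt σ ((StdForm.antidiagonal N).over K)))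
    {μ : Fin N → ℤ} (hμ : ¬ ∀ i, μ (Fin.rev i) = -μ i) :
    ((hd.isIwasawaExponent (N := N)).satakeTransform w T).coeff μ = 0 := by
  classical
  rw [(hd.isIwasawaExponent (N := N)).satakeTransform_apply, IsIwasawaExponent.coeff_satakeVec, Finset.sum_eq_zero, mul_zero]
  intro γ hγ
  rw [Finset.mem_filter] at hγ
  exact absurd (fun i => by rw [← hγ.2, hd.iwasawaExp_rev]) hμ

omit [Valued K ℤᵐ⁰] in
/-- A head sum of length one is the first entry. [cite: BruhatTits1972, (4.4.4)] -/
theorem sum_ite_lt_one [NeZero N] (f : Fin N → ℤ) : (∑ i : Fin N, if (i : ℕ) < 1 then f i else 0) = f 0 := by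
  rw [Finset.sum_eq_single_of_mem (0 : Fin N) (Finset.mem_univ _) fun i _ hi => ?_]
  · rw [if_pos (by simp)]
  · rw [if_neg]
    intro h
    exact hi (Fin.ext (by rw [Fin.val_zero]; omega))

/-! ## §2 Relative rank one, abstractly: a line `ℓ : ℤ → Λ⁻` through the antisymmetric lattice -/

section Linear

variable {R : Type*} [CommRing R] [NeZero N]
  [IsHeckeTriple (⊤ : Submonoid (unitaryGroupOfForm σ ((StdForm.antidiagonal N).over K))) (unitaryInt σ ((StdForm.antidiagonal N).over K)) (unitaryInt σ ((StdForm.antidiagonal N).over K))]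
  (hd : UnramifiedLocalConjDatum σ ϖ) {ℓ : ℤ → Fin N → ℤ}
  (hℓrev : ∀ m i, ℓ m (Fin.rev i) = -ℓ m i) (hℓ0 : ∀ m, ℓ m 0 = m) (hℓmono : ∀ m, m ≤ 0 → Monotone (ℓ m))
include hℓrev hℓ0 hℓmono

/-- **Support of `𝒮_1(T_{t_{ℓ_{-k}}})` (`k ≥ 0`)**: the coefficient of `x^μ` vanishes for `μ 0 < -k` (Bruhat–Tits dominance from
the antidominant end). [cite: BruhatTits1972, Prop. (4.4.4) (i)] -/
theorem coeff_satakeTransform_one_bottom_eq_zero_of_lt (k : ℕ) {μ : Fin N → ℤ} (hμ : μ 0 < -(k : ℤ)) :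
    ((hd.isIwasawaExponent (N := N)).satakeTransform (1 : Multiplicative (Fin N → ℤ) →* R)
        (heckeAlgebra.doubleCosetOperator (unitaryInt σ ((StdForm.antidiagonal N).over K))
          (⟨zpowDiagGL (uniformizer_ne_zero hd.vϖ) (ℓ (-(k : ℤ))), zpowDiagGL_mem_unitaryGroupOfForm hd.σϖ _ (hℓrev _)⟩ :
            unitaryGroupOfForm σ ((StdForm.antidiagonal N).over K)))).coeff μ = 0 := by
  refine (hd.isIwasawaExponent (N := N)).coeff_satakeTransform_doubleCosetOperator_eq_zero 1 fun α hα he => ?_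
  have hα' : (α.out : unitaryGroupOfForm σ ((StdForm.antidiagonal N).over K) ⧸ unitaryInt σ ((StdForm.antidiagonal N).over K)) ∈
      MulAction.orbit (unitaryInt σ ((StdForm.antidiagonal N).over K))
        (((⟨zpowDiagGL (uniformizer_ne_zero hd.vϖ) (ℓ (-(k : ℤ))), zpowDiagGL_mem_unitaryGroupOfForm hd.σϖ _ (hℓrev _)⟩ :
              unitaryGroupOfForm σ ((StdForm.antidiagonal N).over K))) :
          unitaryGroupOfForm σ ((StdForm.antidiagonal N).over K) ⧸ unitaryInt σ ((StdForm.antidiagonal N).over K)) := by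
    rwa [QuotientGroup.out_eq']
  have h := hd.sum_ite_lt_le_sum_iwasawaExp_of_mem_orbit ⟨hℓmono _ (by simp), hℓrev _⟩ rfl hα' 1
  rw [sum_ite_lt_one, sum_ite_lt_one, he, hℓ0] at h
  exact absurd hμ (not_lt.2 h)

omit hℓ0 [NeZero N] in
/-- **Bottom coefficient**: the coefficient of `x^{ℓ_{-k}}` in `𝒮_1(T_{t_{ℓ_{-k}}})` is `1` (the unique bottom coset).
[cite: BruhatTits1972, Prop. (4.4.4) (ii)] [cite: CartierCorvallis1979, §IV, proof of Thm. 4.1 (c)] -/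
theorem coeff_satakeTransform_one_bottom_self (k : ℕ) :
    ((hd.isIwasawaExponent (N := N)).satakeTransform (1 : Multiplicative (Fin N → ℤ) →* R)
        (heckeAlgebra.doubleCosetOperator (unitaryInt σ ((StdForm.antidiagonal N).over K))
          (⟨zpowDiagGL (uniformizer_ne_zero hd.vϖ) (ℓ (-(k : ℤ))), zpowDiagGL_mem_unitaryGroupOfForm hd.σϖ _ (hℓrev _)⟩ :
            unitaryGroupOfForm σ ((StdForm.antidiagonal N).over K)))).coeff (ℓ (-(k : ℤ))) = 1 := by
  rw [hd.coeff_satakeTransform_doubleCosetOperator_zpowDiagGL_monotone_unitary 1 ⟨hℓmono _ (by simp), hℓrev _⟩ rfl,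
    MonoidHom.one_apply]

variable (hℓ : ∀ μ : Fin N → ℤ, (∀ i, μ (Fin.rev i) = -μ i) → μ = ℓ (μ 0)) (hℓanti : ∀ m, 0 ≤ m → Antitone (ℓ m))
include hℓ hℓanti

/-- **`V ⊆ range 𝒮_1`** (relative rank one): every `f ∈ R[ℤ^N]` vanishing off the antisymmetric lattice and satisfying
`f_λ = [K_P : t_λ K_P t_λ⁻¹] · f_{-λ}` for every dominant antisymmetric `λ` is the counting transform of some `T`
(induction from the bottom exponent). [cite: CartierCorvallis1979, §IV, proof of Thm. 4.1 (c)] [cite: Minguez2011, §4] -/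
theorem mem_range_satakeTransform_one_of_linear_unitary (f : AddMonoidAlgebra R (Fin N → ℤ))
    (hf₁ : ∀ μ : Fin N → ℤ, (¬ ∀ i, μ (Fin.rev i) = -μ i) → f.coeff μ = 0)
    (hf₂ : ∀ (μ : Fin N → ℤ) (hμ : ∀ i, μ (Fin.rev i) = -μ i), Antitone μ →
      f.coeff μ = f.coeff (-μ) *
        (((toConjAct (⟨zpowDiagGL (uniformizer_ne_zero hd.vϖ) μ, zpowDiagGL_mem_unitaryGroupOfForm hd.σϖ _ hμ⟩ :
              unitaryGroupOfForm σ ((StdForm.antidiagonal N).over K)) •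
            (hd.borelLatticeU ⊓ unitaryInt σ ((StdForm.antidiagonal N).over K))).relIndex
          (hd.borelLatticeU ⊓ unitaryInt σ ((StdForm.antidiagonal N).over K)) : ℕ) : R)) :
    f ∈ Set.range ((hd.isIwasawaExponent (N := N)).satakeTransform (1 : Multiplicative (Fin N → ℤ) →* R)) := by
  classical
  set 𝒮 := (hd.isIwasawaExponent (N := N)).satakeTransform (1 : Multiplicative (Fin N → ℤ) →* R) with h𝒮
  -- induction on the depth of the bottom exponent
  suffices key : ∀ (k : ℕ) (g : AddMonoidAlgebra R (Fin N → ℤ)),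
      (∀ μ : Fin N → ℤ, (¬ ∀ i, μ (Fin.rev i) = -μ i) → g.coeff μ = 0) →
      (∀ (μ : Fin N → ℤ) (hμ : ∀ i, μ (Fin.rev i) = -μ i), Antitone μ →
        g.coeff μ = g.coeff (-μ) *
          (((toConjAct (⟨zpowDiagGL (uniformizer_ne_zero hd.vϖ) μ, zpowDiagGL_mem_unitaryGroupOfForm hd.σϖ _ hμ⟩ :
                unitaryGroupOfForm σ ((StdForm.antidiagonal N).over K)) •
              (hd.borelLatticeU ⊓ unitaryInt σ ((StdForm.antidiagonal N).over K))).relIndex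
            (hd.borelLatticeU ⊓ unitaryInt σ ((StdForm.antidiagonal N).over K)) : ℕ) : R)) →
      (∀ μ : Fin N → ℤ, μ 0 < -(k : ℤ) → g.coeff μ = 0) → g ∈ Set.range 𝒮 by
    refine key (f.coeff.support.sup fun μ => (-μ 0).toNat) f hf₁ hf₂ fun μ hμ => ?_
    by_contra hne
    have hmem : μ ∈ f.coeff.support := Finsupp.mem_support_iff.2 hne
    have hle : (-μ 0).toNat ≤ f.coeff.support.sup fun μ => (-μ 0).toNat := Finset.le_sup (f := fun μ => (-μ 0).toNat) hmem
    have := Int.self_le_toNat (-μ 0)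
    omega
  intro k
  induction k with
  | zero =>
    intro g hg₁ hg₂ hsupp
    -- `g` is the constant `g_0`
    refine ⟨algebraMap R _ (g.coeff 0), ?_⟩
    rw [AlgHom.commutes, Algebra.algebraMap_eq_smul_one, AddMonoidAlgebra.one_def]
    refine AddMonoidAlgebra.ext (Finsupp.ext fun μ => ?_)
    rw [AddMonoidAlgebra.coeff_smul, Finsupp.smul_apply, AddMonoidAlgebra.coeff_single, Finsupp.single_apply, smul_eq_mul]
    by_cases hμ0 : (0 : Fin N → ℤ) = μ
    · rw [if_pos hμ0, mul_one, ← hμ0]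
    · rw [if_neg hμ0, mul_zero]
      by_cases hrev : ∀ i, μ (Fin.rev i) = -μ i
      · have hμ : μ 0 ≠ 0 := fun h => hμ0 (by
          rw [hℓ μ hrev, h, ← show (0 : Fin N → ℤ) 0 = 0 from rfl, ← hℓ 0 fun i => by simp])
        rcases lt_or_gt_of_ne hμ with hlt | hgt
        · exact (hsupp μ (by simpa using hlt)).symm
        · -- positive: dominant, use the symmetry and the vanishing at `-μ`
          have hanti : Antitone μ := by rw [hℓ μ hrev]; exact hℓanti _ hgt.le
          rw [hg₂ μ hrev hanti, hsupp (-μ) (by simp only [Pi.neg_apply, Nat.cast_zero, neg_zero]; omega), zero_mul]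
      · exact (hg₁ μ hrev).symm
  | succ k ih =>
    intro g hg₁ hg₂ hsupp
    -- subtract the transform of `T_{t_{ℓ_{-(k+1)}}}`
    set c : R := g.coeff (ℓ (-((k + 1 : ℕ) : ℤ))) with hc
    set S := 𝒮 (heckeAlgebra.doubleCosetOperator (unitaryInt σ ((StdForm.antidiagonal N).over K))
      (⟨zpowDiagGL (uniformizer_ne_zero hd.vϖ) (ℓ (-((k + 1 : ℕ) : ℤ))), zpowDiagGL_mem_unitaryGroupOfForm hd.σϖ _ (hℓrev _)⟩ :
        unitaryGroupOfForm σ ((StdForm.antidiagonal N).over K))) with hS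
    have hS₁ : ∀ μ : Fin N → ℤ, (¬ ∀ i, μ (Fin.rev i) = -μ i) → S.coeff μ = 0 :=
      fun _ hμ => hd.coeff_satakeTransform_eq_zero_of_not_rev 1 _ hμ
    have hS₂ : ∀ (μ : Fin N → ℤ) (hμ : ∀ i, μ (Fin.rev i) = -μ i), Antitone μ →
        S.coeff μ = S.coeff (-μ) *
          (((toConjAct (⟨zpowDiagGL (uniformizer_ne_zero hd.vϖ) μ, zpowDiagGL_mem_unitaryGroupOfForm hd.σϖ _ hμ⟩ :
                unitaryGroupOfForm σ ((StdForm.antidiagonal N).over K)) •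
              (hd.borelLatticeU ⊓ unitaryInt σ ((StdForm.antidiagonal N).over K))).relIndex
            (hd.borelLatticeU ⊓ unitaryInt σ ((StdForm.antidiagonal N).over K)) : ℕ) : R) :=
      fun _ hμ hμa => hd.coeff_satakeTransform_one_eq_relIndex_mul_of_antitone_unitary _ hμa hμ
    obtain ⟨T', hT'⟩ := ih (g - c • S)
      (fun μ hμ => by
        simp only [AddMonoidAlgebra.coeff_sub, AddMonoidAlgebra.coeff_smul, Finsupp.sub_apply, Finsupp.smul_apply, smul_eq_mul]
        rw [hg₁ μ hμ, hS₁ μ hμ, mul_zero, sub_zero])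
      (fun μ hμ hμa => by
        simp only [AddMonoidAlgebra.coeff_sub, AddMonoidAlgebra.coeff_smul, Finsupp.sub_apply, Finsupp.smul_apply, smul_eq_mul]
        rw [hg₂ μ hμ hμa, hS₂ μ hμ hμa]
        ring)
      (fun μ hμ => by
        simp only [AddMonoidAlgebra.coeff_sub, AddMonoidAlgebra.coeff_smul, Finsupp.sub_apply, Finsupp.smul_apply, smul_eq_mul]
        rcases lt_or_eq_of_le (show μ 0 ≤ -((k + 1 : ℕ) : ℤ) by push_cast; omega) with hlt | heq
        · rw [hsupp μ hlt, hS, hd.coeff_satakeTransform_one_bottom_eq_zero_of_lt hℓrev hℓ0 hℓmono (k + 1) hlt, mul_zero,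
            sub_zero]
        · by_cases hrev : ∀ i, μ (Fin.rev i) = -μ i
          · have hμ' : μ = ℓ (-((k + 1 : ℕ) : ℤ)) := by rw [hℓ μ hrev, heq]
            rw [hμ', hS, hd.coeff_satakeTransform_one_bottom_self hℓrev hℓmono (k + 1), mul_one, ← hc, sub_self]
          · rw [hg₁ μ hrev, hS₁ μ hrev, mul_zero, sub_zero])
    refine ⟨T' + c • heckeAlgebra.doubleCosetOperator (unitaryInt σ ((StdForm.antidiagonal N).over K))
      (⟨zpowDiagGL (uniformizer_ne_zero hd.vϖ) (ℓ (-((k + 1 : ℕ) : ℤ))), zpowDiagGL_mem_unitaryGroupOfForm hd.σϖ _ (hℓrev _)⟩ :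
        unitaryGroupOfForm σ ((StdForm.antidiagonal N).over K)), ?_⟩
    rw [map_add, map_smul, hT', ← hS, sub_add_cancel]

/-- **THE SATAKE ISOMORPHISM IN RELATIVE RANK ONE** (image): if the antisymmetric lattice is a line `ℓ`, the range of the
counting transform `𝒮_1 : ℋ(U(σ,J₀), K₀; R) → R[ℤ^N]` is exactly `V = {f : f_μ = 0 off the antisymmetric lattice;
f_λ = [K_P : t_λK_Pt_λ⁻¹] · f_{-λ} for dominant antisymmetric λ}`. [cite: CartierCorvallis1979, §IV Thm. 4.1]
[cite: Minguez2011, §4] [cite: Satake1963, §§6–7] -/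
theorem range_satakeTransform_one_of_linear_unitary :
    Set.range ((hd.isIwasawaExponent (N := N)).satakeTransform (1 : Multiplicative (Fin N → ℤ) →* R)) =
      {f | (∀ μ : Fin N → ℤ, (¬ ∀ i, μ (Fin.rev i) = -μ i) → f.coeff μ = 0) ∧
        ∀ (μ : Fin N → ℤ) (hμ : ∀ i, μ (Fin.rev i) = -μ i), Antitone μ →
          f.coeff μ = f.coeff (-μ) *
            (((toConjAct (⟨zpowDiagGL (uniformizer_ne_zero hd.vϖ) μ, zpowDiagGL_mem_unitaryGroupOfForm hd.σϖ _ hμ⟩ :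
                  unitaryGroupOfForm σ ((StdForm.antidiagonal N).over K)) •
                (hd.borelLatticeU ⊓ unitaryInt σ ((StdForm.antidiagonal N).over K))).relIndex
              (hd.borelLatticeU ⊓ unitaryInt σ ((StdForm.antidiagonal N).over K)) : ℕ) : R)} := by
  ext f
  constructor
  · rintro ⟨T, rfl⟩
    exact ⟨fun _ hμ => hd.coeff_satakeTransform_eq_zero_of_not_rev 1 T hμ,
      fun _ hμ hμa => hd.coeff_satakeTransform_one_eq_relIndex_mul_of_antitone_unitary T hμa hμ⟩
  · exact fun hf => hd.mem_range_satakeTransform_one_of_linear_unitary hℓrev hℓ0 hℓmono hℓ hℓanti f hf.1 hf.2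

/-- **`𝒮_1 : ℋ(U(σ,J₀), K₀; R) → V` is a bijection in relative rank one** (injective by the tree, onto `V` by the above).
[cite: CartierCorvallis1979, §IV Thm. 4.1] [cite: Minguez2011, §4] -/
theorem satakeTransform_one_bijective_of_linear_unitary :
    Function.Bijective (fun T : heckeAlgebra R (unitaryGroupOfForm σ ((StdForm.antidiagonal N).over K)) (unitaryInt σ ((StdForm.antidiagonal N).over K)) =>
      (⟨(hd.isIwasawaExponent (N := N)).satakeTransform (1 : Multiplicative (Fin N → ℤ) →* R) T,
        ⟨fun _ hμ => hd.coeff_satakeTransform_eq_zero_of_not_rev 1 T hμ,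
          fun _ hμ hμa => hd.coeff_satakeTransform_one_eq_relIndex_mul_of_antitone_unitary T hμa hμ⟩⟩ :
        {f : AddMonoidAlgebra R (Fin N → ℤ) //
          (∀ μ : Fin N → ℤ, (¬ ∀ i, μ (Fin.rev i) = -μ i) → f.coeff μ = 0) ∧
        ∀ (μ : Fin N → ℤ) (hμ : ∀ i, μ (Fin.rev i) = -μ i), Antitone μ →
          f.coeff μ = f.coeff (-μ) *
            (((toConjAct (⟨zpowDiagGL (uniformizer_ne_zero hd.vϖ) μ, zpowDiagGL_mem_unitaryGroupOfForm hd.σϖ _ hμ⟩ :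
                  unitaryGroupOfForm σ ((StdForm.antidiagonal N).over K)) •
                (hd.borelLatticeU ⊓ unitaryInt σ ((StdForm.antidiagonal N).over K))).relIndex
              (hd.borelLatticeU ⊓ unitaryInt σ ((StdForm.antidiagonal N).over K)) : ℕ) : R)})) := by
  refine ⟨fun T T' h => hd.satakeTransform_injective_of_commRing 1 (congrArg Subtype.val h), fun f => ?_⟩
  obtain ⟨T, hT⟩ := hd.mem_range_satakeTransform_one_of_linear_unitary hℓrev hℓ0 hℓmono hℓ hℓanti f.1 f.2.1 f.2.2
  exact ⟨T, Subtype.ext hT⟩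

end Linear

end UnramifiedLocalConjDatum

/-! ## §3 The lines: `N = 3` (`ℓ_m = (m, 0, -m)`) and `N = 2` (`ℓ_m = (m, -m)`); the isomorphisms for `U(3)` and `U(2)` -/

omit [Valued K ℤᵐ⁰] in
/-- `ℓ_m = (m(1 - i))_i = (m, 0, -m)` is antisymmetric under `rev` (`N = 3`). [cite: BruhatTits1972, (4.4.3)] -/
theorem rev_linear_three (m : ℤ) (i : Fin 3) :
    (fun i : Fin 3 => m * (1 - (i : ℕ))) (Fin.rev i) = -(fun i : Fin 3 => m * (1 - (i : ℕ))) i := by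
  have hi := i.2
  have hcast : (((Fin.rev i : Fin 3) : ℕ) : ℤ) = 2 - ((i : ℕ) : ℤ) := by
    rw [Fin.val_rev]; omega
  simp only [hcast]
  ring

omit [Valued K ℤᵐ⁰] in
/-- **For `N = 3` every antisymmetric exponent is `ℓ_{μ₀} = (μ₀, 0, -μ₀)`.** [cite: BruhatTits1972, (4.4.3)] -/
theorem eq_linear_three_of_rev (μ : Fin 3 → ℤ) (hμ : ∀ i, μ (Fin.rev i) = -μ i) :
    μ = fun i : Fin 3 => μ 0 * (1 - (i : ℕ)) := by
  have h1 : μ 1 = -μ 1 := by have := hμ 1; rwa [show Fin.rev (1 : Fin 3) = 1 from by decide] at this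
  have h2 : μ 2 = -μ 0 := by have := hμ 0; rwa [show Fin.rev (0 : Fin 3) = 2 from by decide] at this
  funext i
  fin_cases i
  · show μ 0 = μ 0 * (1 - ((0 : ℕ) : ℤ)); rw [Nat.cast_zero, sub_zero, mul_one]
  · show μ 1 = μ 0 * (1 - ((1 : ℕ) : ℤ)); rw [Nat.cast_one, sub_self, mul_zero]; omega
  · show μ 2 = μ 0 * (1 - ((2 : ℕ) : ℤ)); rw [h2, Nat.cast_ofNat]; ring

omit [Valued K ℤᵐ⁰] in
/-- `ℓ_m` (`N = 3`) is monotone (antidominant) for `m ≤ 0`. [cite: BruhatTits1972, (4.4.3)] -/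
theorem monotone_linear_three (m : ℤ) (hm : m ≤ 0) : Monotone (fun i : Fin 3 => m * (1 - (i : ℕ))) := fun i j hij => by
  have hij' : ((i : ℕ) : ℤ) ≤ ((j : ℕ) : ℤ) := by exact_mod_cast (show (i : ℕ) ≤ (j : ℕ) from hij)
  simp only
  nlinarith

omit [Valued K ℤᵐ⁰] in
/-- `ℓ_m` (`N = 3`) is antitone (dominant) for `m ≥ 0`. [cite: BruhatTits1972, (4.4.3)] -/
theorem antitone_linear_three (m : ℤ) (hm : 0 ≤ m) : Antitone (fun i : Fin 3 => m * (1 - (i : ℕ))) := fun i j hij => by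
  have hij' : ((i : ℕ) : ℤ) ≤ ((j : ℕ) : ℤ) := by exact_mod_cast (show (i : ℕ) ≤ (j : ℕ) from hij)
  simp only
  nlinarith

omit [Valued K ℤᵐ⁰] in
/-- `ℓ_m = (m(1 - 2i))_i = (m, -m)` is antisymmetric under `rev` (`N = 2`). [cite: BruhatTits1972, (4.4.3)] -/
theorem rev_linear_two (m : ℤ) (i : Fin 2) :
    (fun i : Fin 2 => m * (1 - 2 * (i : ℕ))) (Fin.rev i) = -(fun i : Fin 2 => m * (1 - 2 * (i : ℕ))) i := by
  have hi := i.2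
  have hcast : (((Fin.rev i : Fin 2) : ℕ) : ℤ) = 1 - ((i : ℕ) : ℤ) := by
    rw [Fin.val_rev]; omega
  simp only [hcast]
  ring

omit [Valued K ℤᵐ⁰] in
/-- **For `N = 2` every antisymmetric exponent is `ℓ_{μ₀} = (μ₀, -μ₀)`.** [cite: BruhatTits1972, (4.4.3)] -/
theorem eq_linear_two_of_rev (μ : Fin 2 → ℤ) (hμ : ∀ i, μ (Fin.rev i) = -μ i) :
    μ = fun i : Fin 2 => μ 0 * (1 - 2 * (i : ℕ)) := by
  have h1 : μ 1 = -μ 0 := by have := hμ 0; rwa [show Fin.rev (0 : Fin 2) = 1 from by decide] at this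
  funext i
  fin_cases i
  · show μ 0 = μ 0 * (1 - 2 * ((0 : ℕ) : ℤ)); rw [Nat.cast_zero, mul_zero, sub_zero, mul_one]
  · show μ 1 = μ 0 * (1 - 2 * ((1 : ℕ) : ℤ)); rw [h1, Nat.cast_one]; ring

omit [Valued K ℤᵐ⁰] in
/-- `ℓ_m` (`N = 2`) is monotone for `m ≤ 0`. [cite: BruhatTits1972, (4.4.3)] -/
theorem monotone_linear_two (m : ℤ) (hm : m ≤ 0) : Monotone (fun i : Fin 2 => m * (1 - 2 * (i : ℕ))) := fun i j hij => by
  have hij' : ((i : ℕ) : ℤ) ≤ ((j : ℕ) : ℤ) := by exact_mod_cast (show (i : ℕ) ≤ (j : ℕ) from hij)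
  simp only
  nlinarith

omit [Valued K ℤᵐ⁰] in
/-- `ℓ_m` (`N = 2`) is antitone for `m ≥ 0`. [cite: BruhatTits1972, (4.4.3)] -/
theorem antitone_linear_two (m : ℤ) (hm : 0 ≤ m) : Antitone (fun i : Fin 2 => m * (1 - 2 * (i : ℕ))) := fun i j hij => by
  have hij' : ((i : ℕ) : ℤ) ≤ ((j : ℕ) : ℤ) := by exact_mod_cast (show (i : ℕ) ≤ (j : ℕ) from hij)
  simp only
  nlinarith

namespace UnramifiedLocalConjDatum

variable {R : Type*} [CommRing R]

/-- **THE SATAKE ISOMORPHISM FOR THE UNRAMIFIED `U(3)` OVER ANY COMMUTATIVE RING** (image of the counting transform):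
`range 𝒮_1 = {f : f_μ = 0 off the antisymmetric lattice; f_λ = [K_P : t_λK_Pt_λ⁻¹] · f_{-λ} (λ dominant antisymmetric)}`.
[cite: CartierCorvallis1979, §IV Thm. 4.1] [cite: Minguez2011, §4] [cite: Satake1963, §§6–7] -/
theorem range_satakeTransform_one_unitary_three
    [IsHeckeTriple (⊤ : Submonoid (unitaryGroupOfForm σ ((StdForm.antidiagonal 3).over K))) (unitaryInt σ ((StdForm.antidiagonal 3).over K))
      (unitaryInt σ ((StdForm.antidiagonal 3).over K))]
    (hd : UnramifiedLocalConjDatum σ ϖ) :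
    Set.range ((hd.isIwasawaExponent (N := 3)).satakeTransform (1 : Multiplicative (Fin 3 → ℤ) →* R)) =
      {f | (∀ μ : Fin 3 → ℤ, (¬ ∀ i, μ (Fin.rev i) = -μ i) → f.coeff μ = 0) ∧
        ∀ (μ : Fin 3 → ℤ) (hμ : ∀ i, μ (Fin.rev i) = -μ i), Antitone μ →
          f.coeff μ = f.coeff (-μ) *
            (((toConjAct (⟨zpowDiagGL (uniformizer_ne_zero hd.vϖ) μ, zpowDiagGL_mem_unitaryGroupOfForm hd.σϖ _ hμ⟩ :
                  unitaryGroupOfForm σ ((StdForm.antidiagonal 3).over K)) •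
                (hd.borelLatticeU ⊓ unitaryInt σ ((StdForm.antidiagonal 3).over K))).relIndex
              (hd.borelLatticeU ⊓ unitaryInt σ ((StdForm.antidiagonal 3).over K)) : ℕ) : R)} :=
  hd.range_satakeTransform_one_of_linear_unitary (ℓ := fun m (i : Fin 3) => m * (1 - (i : ℕ))) rev_linear_three
    (fun m => by show m * (1 - ((0 : ℕ) : ℤ)) = m; ring) monotone_linear_three eq_linear_three_of_rev antitone_linear_three

/-- **`𝒮_1 : ℋ(U(σ,J₀), K₀; R) ⥲ V` for `U(3)`** (bijection onto the twisted invariants), every commutative ring `R`.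
[cite: CartierCorvallis1979, §IV Thm. 4.1] [cite: Minguez2011, §4] -/
theorem satakeTransform_one_bijective_unitary_three
    [IsHeckeTriple (⊤ : Submonoid (unitaryGroupOfForm σ ((StdForm.antidiagonal 3).over K))) (unitaryInt σ ((StdForm.antidiagonal 3).over K))
      (unitaryInt σ ((StdForm.antidiagonal 3).over K))]
    (hd : UnramifiedLocalConjDatum σ ϖ) :
    Function.Bijective (fun T : heckeAlgebra R (unitaryGroupOfForm σ ((StdForm.antidiagonal 3).over K)) (unitaryInt σ ((StdForm.antidiagonal 3).over K)) =>
      (⟨(hd.isIwasawaExponent (N := 3)).satakeTransform (1 : Multiplicative (Fin 3 → ℤ) →* R) T,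
        ⟨fun _ hμ => hd.coeff_satakeTransform_eq_zero_of_not_rev 1 T hμ,
          fun _ hμ hμa => hd.coeff_satakeTransform_one_eq_relIndex_mul_of_antitone_unitary T hμa hμ⟩⟩ :
        {f : AddMonoidAlgebra R (Fin 3 → ℤ) //
          (∀ μ : Fin 3 → ℤ, (¬ ∀ i, μ (Fin.rev i) = -μ i) → f.coeff μ = 0) ∧
        ∀ (μ : Fin 3 → ℤ) (hμ : ∀ i, μ (Fin.rev i) = -μ i), Antitone μ →
          f.coeff μ = f.coeff (-μ) *
            (((toConjAct (⟨zpowDiagGL (uniformizer_ne_zero hd.vϖ) μ, zpowDiagGL_mem_unitaryGroupOfForm hd.σϖ _ hμ⟩ :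
                  unitaryGroupOfForm σ ((StdForm.antidiagonal 3).over K)) •
                (hd.borelLatticeU ⊓ unitaryInt σ ((StdForm.antidiagonal 3).over K))).relIndex
              (hd.borelLatticeU ⊓ unitaryInt σ ((StdForm.antidiagonal 3).over K)) : ℕ) : R)})) :=
  hd.satakeTransform_one_bijective_of_linear_unitary (ℓ := fun m (i : Fin 3) => m * (1 - (i : ℕ))) rev_linear_three
    (fun m => by show m * (1 - ((0 : ℕ) : ℤ)) = m; ring) monotone_linear_three eq_linear_three_of_rev antitone_linear_three

/-- **THE SATAKE ISOMORPHISM FOR THE UNRAMIFIED `U(2)` OVER ANY COMMUTATIVE RING** (image of the counting transform).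
[cite: CartierCorvallis1979, §IV Thm. 4.1] [cite: Minguez2011, §4] [cite: Satake1963, §§6–7] -/
theorem range_satakeTransform_one_unitary_two
    [IsHeckeTriple (⊤ : Submonoid (unitaryGroupOfForm σ ((StdForm.antidiagonal 2).over K))) (unitaryInt σ ((StdForm.antidiagonal 2).over K))
      (unitaryInt σ ((StdForm.antidiagonal 2).over K))]
    (hd : UnramifiedLocalConjDatum σ ϖ) :
    Set.range ((hd.isIwasawaExponent (N := 2)).satakeTransform (1 : Multiplicative (Fin 2 → ℤ) →* R)) =
      {f | (∀ μ : Fin 2 → ℤ, (¬ ∀ i, μ (Fin.rev i) = -μ i) → f.coeff μ = 0) ∧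
        ∀ (μ : Fin 2 → ℤ) (hμ : ∀ i, μ (Fin.rev i) = -μ i), Antitone μ →
          f.coeff μ = f.coeff (-μ) *
            (((toConjAct (⟨zpowDiagGL (uniformizer_ne_zero hd.vϖ) μ, zpowDiagGL_mem_unitaryGroupOfForm hd.σϖ _ hμ⟩ :
                  unitaryGroupOfForm σ ((StdForm.antidiagonal 2).over K)) •
                (hd.borelLatticeU ⊓ unitaryInt σ ((StdForm.antidiagonal 2).over K))).relIndex
              (hd.borelLatticeU ⊓ unitaryInt σ ((StdForm.antidiagonal 2).over K)) : ℕ) : R)} :=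
  hd.range_satakeTransform_one_of_linear_unitary (ℓ := fun m (i : Fin 2) => m * (1 - 2 * (i : ℕ))) rev_linear_two
    (fun m => by show m * (1 - 2 * ((0 : ℕ) : ℤ)) = m; ring) monotone_linear_two eq_linear_two_of_rev antitone_linear_two

/-- **`𝒮_1 : ℋ(U(σ,J₀), K₀; R) ⥲ V` for `U(2)`** (bijection onto the twisted invariants), every commutative ring `R`.
[cite: CartierCorvallis1979, §IV Thm. 4.1] [cite: Minguez2011, §4] -/
theorem satakeTransform_one_bijective_unitary_two
    [IsHeckeTriple (⊤ : Submonoid (unitaryGroupOfForm σ ((StdForm.antidiagonal 2).over K))) (unitaryInt σ ((StdForm.antidiagonal 2).over K))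
      (unitaryInt σ ((StdForm.antidiagonal 2).over K))]
    (hd : UnramifiedLocalConjDatum σ ϖ) :
    Function.Bijective (fun T : heckeAlgebra R (unitaryGroupOfForm σ ((StdForm.antidiagonal 2).over K)) (unitaryInt σ ((StdForm.antidiagonal 2).over K)) =>
      (⟨(hd.isIwasawaExponent (N := 2)).satakeTransform (1 : Multiplicative (Fin 2 → ℤ) →* R) T,
        ⟨fun _ hμ => hd.coeff_satakeTransform_eq_zero_of_not_rev 1 T hμ,
          fun _ hμ hμa => hd.coeff_satakeTransform_one_eq_relIndex_mul_of_antitone_unitary T hμa hμ⟩⟩ :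
        {f : AddMonoidAlgebra R (Fin 2 → ℤ) //
          (∀ μ : Fin 2 → ℤ, (¬ ∀ i, μ (Fin.rev i) = -μ i) → f.coeff μ = 0) ∧
        ∀ (μ : Fin 2 → ℤ) (hμ : ∀ i, μ (Fin.rev i) = -μ i), Antitone μ →
          f.coeff μ = f.coeff (-μ) *
            (((toConjAct (⟨zpowDiagGL (uniformizer_ne_zero hd.vϖ) μ, zpowDiagGL_mem_unitaryGroupOfForm hd.σϖ _ hμ⟩ :
                  unitaryGroupOfForm σ ((StdForm.antidiagonal 2).over K)) •
                (hd.borelLatticeU ⊓ unitaryInt σ ((StdForm.antidiagonal 2).over K))).relIndex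
              (hd.borelLatticeU ⊓ unitaryInt σ ((StdForm.antidiagonal 2).over K)) : ℕ) : R)})) :=
  hd.satakeTransform_one_bijective_of_linear_unitary (ℓ := fun m (i : Fin 2) => m * (1 - 2 * (i : ℕ))) rev_linear_two
    (fun m => by show m * (1 - 2 * ((0 : ℕ) : ℤ)) = m; ring) monotone_linear_two eq_linear_two_of_rev antitone_linear_two

end UnramifiedLocalConjDatum

end Literature.NumberTheory.Automorphic.HermitianLattice

end
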